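import Summits.AtomisticToContinuum.FouriersLaw.Theses.CoercivePulse

/-!
# Birth skeleton of crux `CoercivePulse.LinearSpread` (stmt-AtomisticToContinuum-15382) — line `birth`:
# RESPONSE COERCIVITY + PULSE DISSIPATION CALCULUS + DISCRETE NASH ANTICONCENTRATION ⇒ DIFFUSIVE LOWER ENVELOPE

Crux (route `route-AtomisticToContinuum-CoercivePulse`, rank 2, the route's hardest item):

  `LinearSpread` — for `pinnedChain ω₂ lam β γ` (`ω₂, lam, β > 0`, any `γ`), every `T > 0`, every shift- and
  momentum-reversal-invariant DLR Gibbs state `μ_T`, every `μ_T`-preserving, a.e. shift-covariant infinite-volume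
  dynamics `D`, with split-bond site energy `h_x` and AVERAGED equilibrium energy pulse
  `S(x,t) = Cov(h_0, h_x ∘ φ_t)`: if `Σ_x (1+x²)|S(x,t)| < ∞` at every `t`, then there are `m > 0`, `t₂` with
  `m·t ≤ M(t) := Σ_x x² S(x,t)` for all `t ≥ t₂` — the pulse spreads at least diffusively.

## The line (the route's own recorded first line of attack = its TWO-LAYER PLAN for `LinearSpread`, now typed,
## glued and registered; it honours the route text "LinearSpread ⇐ GlobalCoercivity + a strengthened pulse
## calculus, glued by the discrete Nash anticoncentration lemma")

Read the pulse as a discrete parabolic problem `∂ₜS = −∇·F` with RESPONSE CURRENT `F(x,t) = Cov(h_0, j_x ∘ φ_t)`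
(`j_x = bondCurrentZ · x`, so that `ḣ_x = j_{x−1} − j_x` gives `∂ₜS(x,·) = F(x−1,·) − F(x,·)`). Three stubs:

* `stub_globalCoercivity` (GC, the PHYSICS, open): there are `t₀`, `l > 0`, `A` with, for `t ≥ t₀`,
  (i) `l·Σ_x (S(x+1,t)−S(x,t))² ≤ −Σ_x F(x,t)(S(x+1,t)−S(x,t))` (ONE summed response-coercivity inequality:
  the averaged response current is down-gradient in the energy norm — response ELLIPTICITY of the equilibrium
  pulse), (ii) `Σ|S(·,t)| ≤ A`, (iii) `Σ x² S⁻(x,t) = o(t)`. VERBATIM the former route item `GlobalCoercivity`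
  (stmt-AtomisticToContinuum-15155, K1 of card response-conductance-nash-muckenhoupt; grounded NEW/open; left the
  route only under the crux-only rule, closed `moot`, NOT refuted).
* `stub_pulseDissipationCalculus` (PDC, infrastructure, size L): under the crux's own summability guard, the F-side
  calculus of the pulse: `Σ(1+|x|)|F(x,t)| < ∞`; `χ := Σ_x S(x,0) > 0` (= T² × specific heat); conservation
  `Σ_x S(x,t) = χ`; continuity of `t ↦ ΣS²` and `t ↦ ΣF∇S`; the DISSIPATION IDENTITY
  `ΣS(t₂)² − ΣS(t₁)² = 2∫_{t₁}^{t₂} Σ_x F(S(x+1)−S(x))`. A sub-conjunction of the former supports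
  `PulseRegularity` / `PulseIdentities` (stmt-15165 / stmt-15166, closed `moot` under the crux-only rule).
* `stub_nashLowerEnvelope` (NLE, PURE REAL ANALYSIS, size M, provable now): for ANY `S F : ℤ → ℝ → ℝ` with the
  listed summability/continuity, conserved mass `χ > 0`, the dissipation identity, coercivity constant `l > 0`,
  `Σ|S| ≤ A` and `Σx²S⁻ = o(t)`: `∃ m > 0`, `Σ x² S(x,t) ≥ m·t` eventually. VERBATIM the former support
  `NashLowerEnvelope` (stmt-AtomisticToContinuum-15158) which the route-repair planner PROVED (evidence file
  `NashLowerEnvelopeProof.lean` on that item, ≈ 330 lines, lean check rc 0, standard axioms; not importable from the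
  tree, hence a stub here — landing that proof under `Theorems/` closes this stub verbatim). Proof sketch: discrete
  1-D Nash `(Σu²)³ ≤ 4(Σ|u|)⁴ Σ(∇u)²` ⇒ `y = ΣS²` has `y′ = 2ΣF∇S ≤ −2l Σ(∇S)² ≤ −(l/2A⁴) y³` ⇒
  `ΣS(t)² ≤ A²(l(t−t₀))^{−½}`; anticoncentration `χ ≤ (2R+1)^½ ‖S‖₂ + (M + Σx²S⁻)/R²`, `R ≍ χ²√(lt)/A²` ⇒ `M ≥ m t`.

COMPOSITION (sorry-free, `LinearSpread_of`): fix the guarded `(μ, D)`, `h`, `S` of the crux and name the response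
current `F`; GC gives `(t₀, l, A)` + negligible negative part; PDC gives `F`-summability, `χ > 0`, conservation,
continuity, dissipation; NLE at `(S, F, χ, l, A, t₀)` returns exactly the crux's `∃ m t₂, 0 < m ∧ ∀ t ≥ t₂, m t ≤ M t`.

Calibration / honesty: at the harmonic corner `lam = β = 0` (excluded by the hypotheses `0 < lam`, `0 < β`) the
crux is TRUE (`M ≈ 0.19 t²`, ballistic) but GC FAILS (`λ_glob(t) ∝ 1/t`: half the response rides coherent fronts,
card job j002001) — the line proves less than the truth there, never too much; diffusive calibration
`S = χ(4πDt)^{−½}e^{−x²/4Dt}` gives `l = D`, `A = χ`, `m = χ⁵l/2048 ≤ 2Dχ`. If GC holds only time-averaged, the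
stub set pivots to a Gronwall-in-mean NLE (same skeleton shape).

Neither stub is cheaply the crux or the summit (BC3 probes, planner folder `bc/*_probe.lean`, battery
`first | exact? | simpa [X] | (unfold X; simpa) | aesop`, all FAIL): GC is an inequality between two covariance
kernels with no moment content; PDC holds verbatim for a localised (insulating, `M` bounded) pulse; NLE is a
theorem of real analysis with eight hypotheses the crux does not supply.

Disproof used: none on file (`ledger crux ls stmt-AtomisticToContinuum-15382`: no Disproof.lean, no Negative/);
negatives index (FouriersLaw): OddCorrectorDecay (stmt-9139) and DiluteCell far-field Gaussianity (stmt-12890)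
concern other objects — no stub is an instance of either.

Registered stubs (3): `stub_globalCoercivity`, `stub_pulseDissipationCalculus`, `stub_nashLowerEnvelope` — each a
sorried theorem `Holds.stub_<name> : <full statement over tree declarations> := by sorry` plus the by-name handle
`def stub_<name> : Prop := type_of% Holds.stub_<name>` which the layer-invariant audit (`#h21_check_skeleton`)
requires of the hypotheses of `LinearSpread_of`. Skeleton theorem:
`LinearSpread_of : stub_globalCoercivity → stub_pulseDissipationCalculus → stub_nashLowerEnvelope →
CoercivePulse.LinearSpread` (sorry-free; axioms propext / Classical.choice / Quot.sound).
-/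

noncomputable section

namespace Summit.AtomisticToContinuum.FouriersLaw.Cruxes.LinearSpread.Birth

open Filter Topology MeasureTheory
open Literature.MathematicalPhysics.KineticTheory.HeatConduction

/-! ## Part I — the three registered stubs (the ONLY `sorry`s of this file) -/

/-- **Stub 1 — GlobalCoercivity (GC): response coercivity of the equilibrium energy pulse (the physics; open).**
For `pinnedChain ω₂ lam β γ` (`ω₂, lam, β > 0`), `T > 0`, a shift- and momentum-reversal-invariant DLR Gibbs state
`μ`, a `μ`-preserving a.e. shift-covariant infinite-volume dynamics `D`, split-bond site energy `h`, pulse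
`S(x,t) = Cov(h_0, h_x∘φ_t)` and response current `F(x,t) = Cov(h_0, j_x∘φ_t)`: there are `t₀`, `l > 0`, `A` with,
for all `t ≥ t₀`, (i) `l·Σ(∇S)² ≤ −Σ F∇S`, (ii) `Σ|S| ≤ A`, (iii) `Σ x² S⁻ = o(t)`. VERBATIM the former route item
`CoercivePulse.GlobalCoercivity` (stmt-AtomisticToContinuum-15155; card response-conductance-nash-muckenhoupt K1).
Why plausibly true: the kinetic corner (positive hypocoercive linearised pinned-phonon Boltzmann semigroup,
`t₀ ≍ (lam T)⁻²`) gives it at weak anharmonicity; diffusive phenomenology gives `l = D`. Why it might fail: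
coercivity may hold only time-averaged; S⁻ mass on precursor fronts. FALSE at `lam = β = 0` (excluded). -/
theorem Holds.stub_globalCoercivity :
    ∀ ω₂ lam β γ : ℝ, 0 < ω₂ → 0 < lam → 0 < β → ∀ T : ℝ, 0 < T → ∀ μ : MeasureTheory.Measure Literature.MathematicalPhysics.KineticTheory.HeatConduction.ChainConfig, (Literature.MathematicalPhysics.KineticTheory.HeatConduction.pinnedChain ω₂ lam β γ).IsChainGibbsMeasure T μ → Literature.MathematicalPhysics.KineticTheory.HeatConduction.IsShiftInvariant μ → μ.map (fun σ : Literature.MathematicalPhysics.KineticTheory.HeatConduction.ChainConfig => fun x : ℤ => ((σ x).1, -(σ x).2)) = μ → ∀ D : Literature.MathematicalPhysics.KineticTheory.HeatConduction.InfiniteChainDynamics (Literature.MathematicalPhysics.KineticTheory.HeatConduction.pinnedChain ω₂ lam β γ), D.PreservesMeasure μ → (∀ t : ℝ, ∀ᵐ σ ∂μ, D.flow t (Literature.MathematicalPhysics.KineticTheory.HeatConduction.shift σ) = Literature.MathematicalPhysics.KineticTheory.HeatConduction.shift (D.flow t σ)) → ∀ h : Literature.MathematicalPhysics.KineticTheory.HeatConduction.ChainConfig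 → ℤ → ℝ, h = (fun (σ : Literature.MathematicalPhysics.KineticTheory.HeatConduction.ChainConfig) (x : ℤ) => (σ x).2 ^ 2 / 2 + (Literature.MathematicalPhysics.KineticTheory.HeatConduction.pinnedChain ω₂ lam β γ).U (σ x).1 + ((Literature.MathematicalPhysics.KineticTheory.HeatConduction.pinnedChain ω₂ lam β γ).V ((σ (x + 1)).1 - (σ x).1) + (Literature.MathematicalPhysics.KineticTheory.HeatConduction.pinnedChain ω₂ lam β γ).V ((σ x).1 - (σ (x - 1)).1)) / 2) → ∀ S : ℤ → ℝ → ℝ, S = (fun (x : ℤ) (t : ℝ) => ∫ σ, (h σ 0 - ∫ σ', h σ' 0 ∂μ) * (h (D.flow t σ) x - ∫ σ', h σ' 0 ∂μ) ∂μ) → ∀ F : ℤ → ℝ → ℝ, F = (fun (x : ℤ) (t : ℝ) => ∫ σ, (h σ 0 - ∫ σ', h σ' 0 ∂μ) * (Literature.MathematicalPhysics.KineticTheory.HeatConduction.pinnedChain ω₂ lam β γ).bondCurrentZ (D.flow t σ) x ∂μ) → ∃ t₀ l A : ℝ, 0 < l ∧ (∀ t : ℝ, t₀ ≤ t → l * ∑'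 x : ℤ, (S (x + 1) t - S x t) ^ 2 ≤ -∑' x : ℤ, F x t * (S (x + 1) t - S x t)) ∧ (∀ t : ℝ, t₀ ≤ t → ∑' x : ℤ, |S x t| ≤ A) ∧ (∀ ε : ℝ, 0 < ε → ∃ t₁ : ℝ, ∀ t : ℝ, t₁ ≤ t → ∑' x : ℤ, (x : ℝ) ^ 2 * max (-S x t) 0 ≤ ε * t) := by
  sorry

/-- **Stub 2 — PulseDissipationCalculus (PDC): the F-side infinite-volume calculus of the pulse (size L).**
Same arena; under the crux's own guard `Σ_x(1+x²)|S(x,t)| < ∞` (every `t`): `Σ_x(1+|x|)|F(x,t)| < ∞` at every `t`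
(light cone of the infinite-volume flow + exponential clustering of the 1-D Gibbs chain); `0 < χ := Σ_x S(x,0)`
(`T²` × specific heat of a non-degenerate Gibbs state); conservation `Σ_x S(x,t) = χ` (`ḣ_x = j_{x−1} − j_x` summed);
continuity of `t ↦ Σ S²` and of `t ↦ Σ_x F(S(x+1)−S(x))`; and the exact DISSIPATION IDENTITY
`ΣS(t₂)² − ΣS(t₁)² = 2∫_{t₁}^{t₂} Σ_x F(x,s)(S(x+1,s)−S(x,s)) ds` (`∂ₜS(x) = F(x−1) − F(x)`, summation by parts).
A sub-conjunction of the former supports `PulseRegularity`/`PulseIdentities` (stmt-15165/15166). Why it might fail: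
needs a fixed-time light-cone bound for the `deg V′ = 3` infinite dynamics composed with Gibbs clustering and the
sum/derivative exchanges — not printed as typed (BCDM-type bounds exist for other growth classes). -/
theorem Holds.stub_pulseDissipationCalculus :
    ∀ ω₂ lam β γ : ℝ, 0 < ω₂ → 0 < lam → 0 < β → ∀ T : ℝ, 0 < T → ∀ μ : MeasureTheory.Measure Literature.MathematicalPhysics.KineticTheory.HeatConduction.ChainConfig, (Literature.MathematicalPhysics.KineticTheory.HeatConduction.pinnedChain ω₂ lam β γ).IsChainGibbsMeasure T μ → Literature.MathematicalPhysics.KineticTheory.HeatConduction.IsShiftInvariant μ → μ.map (fun σ : Literature.MathematicalPhysics.KineticTheory.HeatConduction.ChainConfig => fun x : ℤ => ((σ x).1, -(σ x).2)) = μ → ∀ D : Literature.MathematicalPhysics.KineticTheory.HeatConduction.InfiniteChainDynamics (Literature.MathematicalPhysics.KineticTheory.HeatConduction.pinnedChain ω₂ lam β γ), D.PreservesMeasure μ → (∀ t : ℝ, ∀ᵐ σ ∂μ, D.flow t (Literature.MathematicalPhysics.KineticTheory.HeatConduction.shift σ) = Literature.MathematicalPhysics.KineticTheory.HeatConduction.shift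 (D.flow t σ)) → ∀ h : Literature.MathematicalPhysics.KineticTheory.HeatConduction.ChainConfig → ℤ → ℝ, h = (fun (σ : Literature.MathematicalPhysics.KineticTheory.HeatConduction.ChainConfig) (x : ℤ) => (σ x).2 ^ 2 / 2 + (Literature.MathematicalPhysics.KineticTheory.HeatConduction.pinnedChain ω₂ lam β γ).U (σ x).1 + ((Literature.MathematicalPhysics.KineticTheory.HeatConduction.pinnedChain ω₂ lam β γ).V ((σ (x + 1)).1 - (σ x).1) + (Literature.MathematicalPhysics.KineticTheory.HeatConduction.pinnedChain ω₂ lam β γ).V ((σ x).1 - (σ (x - 1)).1)) / 2) → ∀ S : ℤ → ℝ → ℝ, S = (fun (x : ℤ) (t : ℝ) => ∫ σ, (h σ 0 - ∫ σ', h σ' 0 ∂μ) * (h (D.flow t σ) x - ∫ σ', h σ' 0 ∂μ) ∂μ) → ∀ F : ℤ → ℝ → ℝ, F = (fun (x : ℤ) (t : ℝ) => ∫ σ, (h σ 0 - ∫ σ', h σ' 0 ∂μ) * (Literature.MathematicalPhysics.KineticTheory.HeatConduction.pinnedChain ω₂ lam β γ).bondCurrentZ (D.flow t σ) x ∂μ)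 → (∀ t : ℝ, Summable (fun x : ℤ => (1 + (x : ℝ) ^ 2) * |S x t|)) → (∀ t : ℝ, Summable (fun x : ℤ => (1 + |(x : ℝ)|) * |F x t|)) ∧ (0 < ∑' x : ℤ, S x 0) ∧ (∀ t : ℝ, ∑' x : ℤ, S x t = ∑' x : ℤ, S x 0) ∧ Continuous (fun t : ℝ => ∑' x : ℤ, (S x t) ^ 2) ∧ Continuous (fun t : ℝ => ∑' x : ℤ, F x t * (S (x + 1) t - S x t)) ∧ (∀ t₁ t₂ : ℝ, (∑' x : ℤ, (S x t₂) ^ 2) - (∑' x : ℤ, (S x t₁) ^ 2) = 2 * ∫ s in t₁..t₂, ∑' x : ℤ, F x s * (S (x + 1) s - S x s)) := by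
  sorry

/-- **Stub 3 — NashLowerEnvelope (NLE): discrete Nash anticoncentration (pure real analysis, size M, provable now).**
For `S F : ℤ → ℝ → ℝ` and reals `χ, l > 0`, `A`, `t₀`: if for `t ≥ t₀` the profiles are summable with weights
`1+x²` / `1+|x|`, `Σ_x S(x,t) = χ`, `t ↦ ΣS²` and `t ↦ ΣF∇S` are continuous on `[t₀,∞)`, the dissipation identity
`ΣS(t₂)² − ΣS(t₁)² = 2∫_{t₁}^{t₂}ΣF∇S` holds, coercivity `l·Σ(∇S)² ≤ −ΣF∇S`, `Σ|S| ≤ A`, and `Σx²S⁻ = o(t)`, then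
`∃ m > 0, t₂` with `m·t ≤ Σ_x x² S(x,t)` for `t ≥ t₂`. VERBATIM the former support `CoercivePulse.NashLowerEnvelope`
(stmt-AtomisticToContinuum-15158), PROVED by the route-repair planner (evidence `NashLowerEnvelopeProof.lean` on
that item: discrete 1-D Nash `(Σu²)³ ≤ 4(Σ|u|)⁴Σ(∇u)²`, ODE comparison `y′ ≤ −(l/2A⁴)y³` via
`monotoneOn_of_deriv_nonneg`, anticoncentration `χ ≤ (2R+1)^½‖S‖₂ + (M + Σx²S⁻)/R²` with `R ≍ χ²√(lt)/A²`;
lean check rc 0, standard axioms). Why it might fail: it does not (proved); only its re-landing is owed.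
[Nash 1958 doi:10.2307/2372841; Fabes–Stroock doi:10.1007/BF00251802] -/
theorem Holds.stub_nashLowerEnvelope :
    ∀ (S F : ℤ → ℝ → ℝ) (χ l A t₀ : ℝ), 0 < χ → 0 < l → (∀ t : ℝ, t₀ ≤ t → Summable (fun x : ℤ => (1 + (x : ℝ) ^ 2) * |S x t|) ∧ Summable (fun x : ℤ => (1 + |(x : ℝ)|) * |F x t|)) → (∀ t : ℝ, t₀ ≤ t → ∑' x : ℤ, S x t = χ) → ContinuousOn (fun t : ℝ => ∑' x : ℤ, (S x t) ^ 2) (Set.Ici t₀) → ContinuousOn (fun t : ℝ => ∑' x : ℤ, F x t * (S (x + 1) t - S x t)) (Set.Ici t₀) → (∀ t₁ t₂ : ℝ, t₀ ≤ t₁ → t₁ ≤ t₂ → (∑' x : ℤ, (S x t₂) ^ 2) - (∑' x : ℤ, (S x t₁) ^ 2) = 2 * ∫ s in t₁..t₂, ∑' x : ℤ, F x s * (S (x + 1) s - S x s)) → (∀ t : ℝ, t₀ ≤ t → l * ∑' x : ℤ, (S (x + 1) t - S x t) ^ 2 ≤ -∑' x : ℤ, F x t * (S (x + 1) t - S x t))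 → (∀ t : ℝ, t₀ ≤ t → ∑' x : ℤ, |S x t| ≤ A) → (∀ ε : ℝ, 0 < ε → ∃ t₁ : ℝ, ∀ t : ℝ, t₁ ≤ t → ∑' x : ℤ, (x : ℝ) ^ 2 * max (-S x t) 0 ≤ ε * t) → ∃ m t₂ : ℝ, 0 < m ∧ ∀ t : ℝ, t₂ ≤ t → m * t ≤ ∑' x : ℤ, (x : ℝ) ^ 2 * S x t := by
  sorry

/-! ### By-name handles of the three statements (no second copy of the text) -/

/-- Statement of registered stub 1 (`Holds.stub_globalCoercivity`), by name. -/
def stub_globalCoercivity : Prop := type_of% Holds.stub_globalCoercivity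

/-- Statement of registered stub 2 (`Holds.stub_pulseDissipationCalculus`), by name. -/
def stub_pulseDissipationCalculus : Prop := type_of% Holds.stub_pulseDissipationCalculus

/-- Statement of registered stub 3 (`Holds.stub_nashLowerEnvelope`), by name. -/
def stub_nashLowerEnvelope : Prop := type_of% Holds.stub_nashLowerEnvelope

/-! ## Part II — the skeleton theorem: the three stubs give the crux BY NAME (sorry-free) -/

/-- **`LinearSpread_of`** — `stub_globalCoercivity → stub_pulseDissipationCalculus → stub_nashLowerEnvelope →
CoercivePulse.LinearSpread` (kernel-checked; axioms propext / Classical.choice / Quot.sound). Fix the guarded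
`(μ, D)`, the site energy `h` and the pulse `S` of the crux, name the response current
`F(x,t) = ∫ (h σ 0 − E h_0)·j_x(φ_t σ) dμ`; GC gives `(t₀, l, A)` and the negligible negative part, PDC the
`F`-summability, `χ = Σ_x S(x,0) > 0`, conservation, continuity and the dissipation identity; NLE at
`(S, F, χ, l, A, t₀)` is exactly the crux's conclusion. [folklore] -/
theorem LinearSpread_of (hGC : stub_globalCoercivity) (hPC : stub_pulseDissipationCalculus)
    (hN : stub_nashLowerEnvelope) :
    Summit.AtomisticToContinuum.FouriersLaw.Theses.CoercivePulse.LinearSpread := by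
  intro ω₂ lam β γ hω hl hβ T hT μ hG hSI hRefl D hP hShift h hh S hS hSum
  -- the response current, as an opaque function with its defining equation
  obtain ⟨F, hF⟩ : ∃ F : ℤ → ℝ → ℝ, F = (fun (x : ℤ) (t : ℝ) =>
      ∫ σ, (h σ 0 - ∫ σ', h σ' 0 ∂μ) * (pinnedChain ω₂ lam β γ).bondCurrentZ (D.flow t σ) x ∂μ) := ⟨_, rfl⟩
  obtain ⟨t₀, l, A, hl0, hcoer, hA, hneg⟩ :=
    hGC ω₂ lam β γ hω hl hβ T hT μ hG hSI hRefl D hP hShift h hh S hS F hF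
  obtain ⟨hFsum, hχ, hcons, hcS2, hcP, hdiss⟩ :=
    hPC ω₂ lam β γ hω hl hβ T hT μ hG hSI hRefl D hP hShift h hh S hS F hF hSum
  exact hN S F (∑' x : ℤ, S x 0) l A t₀ hχ hl0 (fun t _ => ⟨hSum t, hFsum t⟩) (fun t _ => hcons t)
    hcS2.continuousOn hcP.continuousOn (fun t₁ t₂ _ _ => hdiss t₁ t₂) hcoer hA hneg

/-- D-0027 §3.3 shape: the crux from the registered stubs (an `example`, so that `LinearSpread_of` stays the unique
theorem concluding the crux; it becomes a proof once the three `sorry`s are discharged). -/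
example : Summit.AtomisticToContinuum.FouriersLaw.Theses.CoercivePulse.LinearSpread :=
  LinearSpread_of Holds.stub_globalCoercivity Holds.stub_pulseDissipationCalculus Holds.stub_nashLowerEnvelope

end Summit.AtomisticToContinuum.FouriersLaw.Cruxes.LinearSpread.Birth

end
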